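import Summits.CriticalPhenomena.PercolationContinuityZ3.Theorems.PercShatteringRaceNearLinearTwoClusterDecayStubVdbdCubeSurj
import Mathlib.Analysis.Convex.PathConnected
import Literature.Probability.LatticeModels.ThermodynamicLimit
import HarnessLib

/-!
# Crux `PercShatteringRace.NearLinearTwoClusterDecay` (stmt-CriticalPhenomena-5785) — frontier stub V3b `stub_vdbdCovering`

Helper file of the line `pair-decay-long-arms-dense`; lands with `--supports stmt-CriticalPhenomena-5785`
(registered stub `stub_vdbdCovering`, § V wave 2 of the skeleton: van den Berg–Don's covering step,
paper Lemma 14 together with Lemma 12 / Definition 13, specialised to `d = 3`).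

## Statement

`stub_vdbdCovering` (**van den Berg–Don 2020, Lemma 14, `d = 3`**; purely deterministic): for each axis
`i : Fin 3` let `g i 0, …, g i (L i)` be lattice points of the cube `Λ_n = box 3 n` with `ℓ¹`-steps `≤ 1`
(consecutive points equal or adjacent), starting on the face `{x_i = -n}` and ending on the face
`{x_i = n}`. Then every lattice point `x ∈ [0, n]³` is within `ℓ¹`-distance `1` of a signed sum
`z₀ + z₁ + z₂`, where `z_b = ε_b ⊙ g b (j b)` is a point of the `b`-th sequence with its coordinates
multiplied by signs `ε b c ∈ {±1}` (coordinatewise, `ℤˣ`-valued).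

## Proof

(1) *Polylines* (`exists_path_range_subset`): joining consecutive points by straight segments
(`Path.segment`, `Path.trans`) gives a path `γ_b` in `ℝ³` from `g b 0` to `g b (L b)` whose range lies in
`{g b 0} ∪ ⋃_{j < L b} [g b j, g b (j+1)]`; we use its extension `γ_b.extend : ℝ → ℝ³`
(`exists_interpolation`). (2) Every point of it has all coordinates in `[-n, n]`
(`abs_apply_le_of_mem_segment`) and is within `ℓ¹`-distance `1/2` of a sequence point: the nearer
endpoint of a segment of `ℓ¹`-length `≤ 1` (`sum_abs_sub_le_half_or`). (3) The map
`G(t)_i = (γ_i(t_i))_i + | |(γ_{o₁ i}(t_{o₁ i}))_i| - |(γ_{o₂ i}(t_{o₂ i}))_i| |` (`{i, o₁ i, o₂ i} =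
{0, 1, 2}`) is continuous with `G(t)_i ≤ -n + n = 0` on `{t_i = 0}` and `G(t)_i ≥ n` on `{t_i = 1}`, so by
the LANDED Poincaré–Miranda stub V3a (`stub_vdbdCubeSurj`, van den Berg–Don Lemma 18) `G t = x` for
some `t` in the unit cube. (4) *Signs* (`exists_units_abs_abs_sub_abs`, the paper's property (h-prop)
for `d - 1 = 2`): `| |u| - |v| | = e₁ u + e₂ v` with `e₁, e₂ ∈ {±1}`, whence
`x_c = Σ_b ε_{b c} (γ_b(t_b))_c` with `ε_{c c} = 1` (`exists_signs_eq_sum`). (5) Replacing each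
`γ_b(t_b)` by its nearest sequence point costs `≤ 3 · (1/2) = 3/2` in `ℓ¹` (`|ε| = 1`,
`Finset.abs_sum_le_sum_abs`, `Finset.sum_comm`), and an integer `≤ 3/2` is `≤ 1`.

## Mathlib / tree search

Mathlib v4.32.0: `Path.segment`, `Path.range_segment` (`Mathlib/Analysis/Convex/PathConnected`),
`Path.trans_range`, `Path.refl_range`, `Path.extend`, `Path.extend_range`, `Path.extend_zero/one`,
`Path.continuous_extend` (`Mathlib/Topology/Path`), `segment`, `Fin.sum_univ_three`,
`Finset.abs_sum_le_sum_abs`, `Finset.sum_comm`, `Int.units_eq_one_or`, the `Matrix.cons_val` simproc.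
No polyline / lattice-path interpolation API in Mathlib or the tree (`lean search 'polyline'`,
`'Polygonal'`: unrelated hits only), hence the short induction here. Tree: `box`, `mem_box`, `Site`
(`Literature.Probability.LatticeModels`), `stub_vdbdCubeSurj` (this line, V3a).

## References

* J. van den Berg, H. Don, *A lower bound for point-to-point connection probabilities in critical
  percolation*, Electron. Commun. Probab. 25 (2020), paper no. 47, Lemma 12, Definition 13, Lemma 14
  [VandenbergDon2020].
-/

namespace Summit.CriticalPhenomena.PercolationContinuityZ3.Theorems

open Literature.Probability.LatticeModels

namespace NearLinearTwoClusterDecayVdbdCovering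

/-- **Polylines** (van den Berg–Don 2020, proof of Lemma 14, "connecting consecutive vertices by line
segments"): for every sequence `q 0, q 1, …` of points of `ℝ³` and every `L` there is a path from `q 0`
to `q L` whose range is contained in `{q 0} ∪ ⋃_{j < L} [q j, q (j+1)]` (the singleton covers `L = 0`).
[cite: VandenbergDon2020, Lemma 14] -/
theorem exists_path_range_subset (q : ℕ → Fin 3 → ℝ) (L : ℕ) :
    ∃ γ : Path (q 0) (q L), Set.range γ ⊆ {q 0} ∪ ⋃ j < L, segment ℝ (q j) (q (j + 1)) := by
  induction L with
  | zero => exact ⟨Path.refl _, by rw [Path.refl_range]; exact Set.subset_union_left⟩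
  | succ L ih =>
    obtain ⟨γ, hγ⟩ := ih
    refine ⟨γ.trans (Path.segment (q L) (q (L + 1))), ?_⟩
    rw [Path.trans_range, Path.range_segment]
    rintro p (hp | hp)
    · rcases hγ hp with hp0 | hpj
      · exact Or.inl hp0
      · refine Or.inr ?_
        simp only [Set.mem_iUnion] at hpj ⊢
        obtain ⟨j, hj, hpj⟩ := hpj
        exact ⟨j, Nat.lt_succ_of_lt hj, hpj⟩
    · refine Or.inr ?_
      simp only [Set.mem_iUnion]
      exact ⟨L, Nat.lt_succ_self L, hp⟩

/-- **Nearest endpoint of a short segment** (van den Berg–Don 2020, proof of Lemma 14: "`|y - w| ≤ 1/2`,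
`w` the nearest point of the lattice path"): a point of a segment `[u, v] ⊆ ℝ³` of `ℓ¹`-length `≤ 1` is
within `ℓ¹`-distance `1/2` of `u` or of `v`. [cite: VandenbergDon2020, Lemma 14] -/
theorem sum_abs_sub_le_half_or {u v p : Fin 3 → ℝ} (h : ∑ c, |u c - v c| ≤ 1)
    (hp : p ∈ segment ℝ u v) :
    ∑ c, |p c - u c| ≤ 1 / 2 ∨ ∑ c, |p c - v c| ≤ 1 / 2 := by
  obtain ⟨a, b, ha, hb, hab, rfl⟩ := hp
  have hsum : 0 ≤ ∑ c, |u c - v c| := Finset.sum_nonneg fun c _ => abs_nonneg _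
  rcases le_total b (1 / 2) with hb2 | hb2
  · refine Or.inl ?_
    calc ∑ c, |(a • u + b • v) c - u c| = ∑ c, b * |u c - v c| := by
          refine Finset.sum_congr rfl fun c _ => ?_
          have hc : (a • u + b • v) c - u c = b * (v c - u c) := by
            have ha' : a = 1 - b := by linarith
            simp only [Pi.add_apply, Pi.smul_apply, smul_eq_mul, ha']
            ring
          rw [hc, abs_mul, abs_of_nonneg hb, abs_sub_comm]
      _ = b * ∑ c, |u c - v c| := by rw [Finset.mul_sum]
      _ ≤ 1 / 2 * 1 := mul_le_mul hb2 h hsum (by norm_num)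
      _ = 1 / 2 := by norm_num
  · refine Or.inr ?_
    have ha2 : a ≤ 1 / 2 := by linarith
    calc ∑ c, |(a • u + b • v) c - v c| = ∑ c, a * |u c - v c| := by
          refine Finset.sum_congr rfl fun c _ => ?_
          have hc : (a • u + b • v) c - v c = a * (u c - v c) := by
            have hb' : b = 1 - a := by linarith
            simp only [Pi.add_apply, Pi.smul_apply, smul_eq_mul, hb']
            ring
          rw [hc, abs_mul, abs_of_nonneg ha]
      _ = a * ∑ c, |u c - v c| := by rw [Finset.mul_sum]
      _ ≤ 1 / 2 * 1 := mul_le_mul ha2 h hsum (by norm_num)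
      _ = 1 / 2 := by norm_num

/-- **Segments stay in the cube**: if all coordinates of `u` and `v` are bounded by `r` in absolute value,
so are those of every point of `[u, v]` (convexity of the sup-ball). [folklore] -/
theorem abs_apply_le_of_mem_segment {u v p : Fin 3 → ℝ} {r : ℝ} (hu : ∀ c, |u c| ≤ r)
    (hv : ∀ c, |v c| ≤ r) (hp : p ∈ segment ℝ u v) (c : Fin 3) : |p c| ≤ r := by
  obtain ⟨a, b, ha, hb, hab, rfl⟩ := hp
  simp only [Pi.add_apply, Pi.smul_apply, smul_eq_mul]
  calc |a * u c + b * v c| ≤ |a * u c| + |b * v c| := abs_add_le _ _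
    _ = a * |u c| + b * |v c| := by rw [abs_mul, abs_mul, abs_of_nonneg ha, abs_of_nonneg hb]
    _ ≤ a * r + b * r :=
        add_le_add (mul_le_mul_of_nonneg_left (hu c) ha) (mul_le_mul_of_nonneg_left (hv c) hb)
    _ = r := by rw [← add_mul, hab, one_mul]

/-- **Continuous interpolation of a lattice path** (van den Berg–Don 2020, Definition 13 (`Λ̄_n`,
polylines of `Λ_n`) and the "nearest point `w`" step of the proof of Lemma 14, `d = 3`): a sequence
`g 0, …, g L` of points of `box 3 n` with `ℓ¹`-steps `≤ 1` is interpolated by a continuous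
`f : ℝ → ℝ³` with `f 0 = g 0`, `f 1 = g L`, all coordinates of every `f s` in `[-n, n]`, and every `f s`
within `ℓ¹`-distance `1/2` of some `g j`, `j ≤ L`. [cite: VandenbergDon2020, Lemma 14] -/
theorem exists_interpolation (n L : ℕ) (g : ℕ → Site 3)
    (hstep : ∀ j < L, ∑ c, |g j c - g (j + 1) c| ≤ 1) (hbox : ∀ j ≤ L, g j ∈ box 3 n) :
    ∃ f : ℝ → Fin 3 → ℝ, Continuous f ∧ (f 0 = fun c => (g 0 c : ℝ)) ∧
      (f 1 = fun c => (g L c : ℝ)) ∧ (∀ s c, |f s c| ≤ n) ∧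
      ∀ s, ∃ j ≤ L, ∑ c, |f s c - g j c| ≤ 1 / 2 := by
  obtain ⟨γ, hγ⟩ := exists_path_range_subset (fun j c => (g j c : ℝ)) L
  have hmem : ∀ s : ℝ, (γ.extend s = fun c => (g 0 c : ℝ)) ∨
      ∃ j < L, γ.extend s ∈ segment ℝ (fun c => (g j c : ℝ)) (fun c => (g (j + 1) c : ℝ)) := by
    intro s
    have hs : γ.extend s ∈ Set.range γ := by
      rw [← Path.extend_range]
      exact Set.mem_range_self s
    simpa only [Set.mem_union, Set.mem_singleton_iff, Set.mem_iUnion, exists_prop] using hγ hs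
  have hq : ∀ j ≤ L, ∀ c, |(g j c : ℝ)| ≤ n := by
    intro j hj c
    have h := (mem_box.1 (hbox j hj)) c
    rw [abs_le]
    exact ⟨by exact_mod_cast h.1, by exact_mod_cast h.2⟩
  have hst : ∀ j < L, ∑ c, |(g j c : ℝ) - (g (j + 1) c : ℝ)| ≤ 1 := by
    intro j hj
    have h := hstep j hj
    exact_mod_cast h
  refine ⟨γ.extend, γ.continuous_extend, γ.extend_zero, γ.extend_one, fun s c => ?_, fun s => ?_⟩
  · rcases hmem s with h0 | ⟨j, hjL, hp⟩
    · rw [h0]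
      exact hq 0 (Nat.zero_le _) c
    · exact abs_apply_le_of_mem_segment (hq j hjL.le) (hq (j + 1) (Nat.succ_le_of_lt hjL)) hp c
  · rcases hmem s with h0 | ⟨j, hjL, hp⟩
    · refine ⟨0, Nat.zero_le _, ?_⟩
      rw [h0]
      norm_num
    · rcases sum_abs_sub_le_half_or (hst j hjL) hp with h | h
      · exact ⟨j, hjL.le, h⟩
      · exact ⟨j + 1, Nat.succ_le_of_lt hjL, h⟩

/-- `|u| = s · u` for a sign `s ∈ ℤˣ`. [folklore] -/
theorem exists_units_abs_eq (u : ℝ) : ∃ s : ℤˣ, |u| = ((s : ℤ) : ℝ) * u := by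
  rcases le_total 0 u with hu | hu
  · exact ⟨1, by simp [abs_of_nonneg hu]⟩
  · exact ⟨-1, by simp [abs_of_nonpos hu]⟩

/-- **The sign bookkeeping (h-prop) of van den Berg–Don 2020 for `d - 1 = 2`** (§2.3, the function
`h(u, v) = | |u| - |v| |`): `| |u| - |v| | = e₁ u + e₂ v` for suitable signs `e₁, e₂ ∈ {±1}`.
[cite: VandenbergDon2020, Lemma 14] -/
theorem exists_units_abs_abs_sub_abs (u v : ℝ) :
    ∃ e₁ e₂ : ℤˣ, |(|u| - |v|)| = ((e₁ : ℤ) : ℝ) * u + ((e₂ : ℤ) : ℝ) * v := by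
  obtain ⟨su, hsu⟩ := exists_units_abs_eq u
  obtain ⟨sv, hsv⟩ := exists_units_abs_eq v
  obtain ⟨σ, hσ⟩ := exists_units_abs_eq (|u| - |v|)
  refine ⟨σ * su, -(σ * sv), ?_⟩
  rw [hσ, hsu, hsv]
  push_cast
  ring

/-- `| |u| - |v| | ≤ r` when `|u|, |v| ≤ r` (both `|u|` and `|v|` lie in `[0, r]`). [folklore] -/
theorem abs_abs_sub_abs_le {u v r : ℝ} (hu : |u| ≤ r) (hv : |v| ≤ r) : |(|u| - |v|)| ≤ r :=
  abs_sub_le_iff.2 ⟨by linarith [abs_nonneg v], by linarith [abs_nonneg u]⟩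

/-- **The topological step of van den Berg–Don 2020, Lemma 14 (`d = 3`)**: given three continuous
curves `f b : ℝ → ℝ³` with `(f b 0)_b = -n`, `(f b 1)_b = n` and all coordinates bounded by `n`, the map
`G(t)_i = (f i (t i))_i + | |(f (o₁ i) (t (o₁ i)))_i| - |(f (o₂ i) (t (o₂ i)))_i| |` (`o₁ = ![1,0,0]`,
`o₂ = ![2,2,1]` the two other indices) satisfies the face conditions of the Poincaré–Miranda stub
`stub_vdbdCubeSurj` with `lo = 0`, `hi = n`; a solution `t` of `G t = a` and the sign bookkeeping
`exists_units_abs_abs_sub_abs` write every `a ∈ [0, n]³` as `a_c = Σ_b ε_{b c} (f b (t b))_c` with signs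
`ε_{b c} ∈ ℤˣ`. [cite: VandenbergDon2020, Lemma 14] -/
theorem exists_signs_eq_sum (n : ℕ) (f : Fin 3 → ℝ → Fin 3 → ℝ) (hf : ∀ b, Continuous (f b))
    (h0 : ∀ b, f b 0 b = -(n : ℝ)) (h1 : ∀ b, f b 1 b = n) (hbd : ∀ b s c, |f b s c| ≤ n)
    (a : Fin 3 → ℝ) (ha : ∀ c, 0 ≤ a c ∧ a c ≤ n) :
    ∃ t : Fin 3 → ℝ, ∃ ε : Fin 3 → Fin 3 → ℤˣ,
      ∀ c, a c = ∑ b, ((ε b c : ℤ) : ℝ) * f b (t b) c := by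
  -- the two "other" indices of each row: `{i, o₁ i, o₂ i} = {0, 1, 2}`
  obtain ⟨o₁, ho₁⟩ : ∃ o : Fin 3 → Fin 3, o = ![1, 0, 0] := ⟨_, rfl⟩
  obtain ⟨o₂, ho₂⟩ : ∃ o : Fin 3 → Fin 3, o = ![2, 2, 1] := ⟨_, rfl⟩
  have hC : ∀ b c, Continuous fun t : Fin 3 → ℝ => f b (t b) c := fun b c =>
    (continuous_apply c).comp ((hf b).comp (continuous_apply b))
  obtain ⟨t, -, ht⟩ := stub_vdbdCubeSurj 3
    (fun t i => f i (t i) i + |(|f (o₁ i) (t (o₁ i)) i| - |f (o₂ i) (t (o₂ i)) i|)|)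
    (fun _ => 0) (fun _ => (n : ℝ))
    (continuous_pi fun i =>
      (hC i i).add (((hC (o₁ i) i).abs.sub (hC (o₂ i) i).abs).abs)).continuousOn
    (fun t _ i hi => by
      rw [hi, h0]
      linarith [abs_abs_sub_abs_le (hbd (o₁ i) (t (o₁ i)) i) (hbd (o₂ i) (t (o₂ i)) i)])
    (fun t _ i hi => by
      rw [hi, h1]
      linarith [abs_nonneg (|f (o₁ i) (t (o₁ i)) i| - |f (o₂ i) (t (o₂ i)) i|)])
    a (fun c => (ha c).1) (fun c => (ha c).2)
  choose e₁ e₂ he using fun c =>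
    exists_units_abs_abs_sub_abs (f (o₁ c) (t (o₁ c)) c) (f (o₂ c) (t (o₂ c)) c)
  refine ⟨t, fun b c => if b = c then 1 else if b = o₁ c then e₁ c else e₂ c, fun c => ?_⟩
  have htc : f c (t c) c + |(|f (o₁ c) (t (o₁ c)) c| - |f (o₂ c) (t (o₂ c)) c|)| = a c :=
    congr_fun ht c
  rw [← htc, he c]
  subst ho₁ ho₂
  fin_cases c <;> simp [Fin.sum_univ_three] <;> ring

end NearLinearTwoClusterDecayVdbdCovering

/-- **Frontier stub V3b (`vdbdCovering`) — van den Berg–Don 2020 Lemma 14 (with Lemma 12 /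
Definition 13), `d = 3`.** For each axis `i : Fin 3` let `g i 0, …, g i (L i)` be a sequence of
lattice points of `Λ_n = box 3 n` with `ℓ¹`-steps `≤ 1` from the face `{x_i = -n}` to the face
`{x_i = n}`. Then every lattice point `x ∈ [0, n]³` is within `ℓ¹`-distance `1` of
`Σ_b ε_b ⊙ g b (j b)` for some indices `j b ≤ L b` and coordinatewise signs `ε b c ∈ ℤˣ`: interpolate
the sequences by polylines, solve `G t = x` by Poincaré–Miranda (V3a `stub_vdbdCubeSurj`), expand the
absolute values into signs, and round each polyline point to its nearest sequence point (total `ℓ¹` error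
`≤ 3/2 < 2`, an integer). [cite: VandenbergDon2020, Lemma 14] -/
theorem stub_vdbdCovering :
    ∀ (n : ℕ) (L : Fin 3 → ℕ) (g : Fin 3 → ℕ → Site 3),
      (∀ i, g i 0 i = -(n : ℤ)) → (∀ i, g i (L i) i = n) →
      (∀ i, ∀ j < L i, ∑ c, |g i j c - g i (j + 1) c| ≤ 1) →
      (∀ i, ∀ j ≤ L i, g i j ∈ box 3 n) →
      ∀ x : Site 3, (∀ c, 0 ≤ x c ∧ x c ≤ n) →
        ∃ j : Fin 3 → ℕ, (∀ i, j i ≤ L i) ∧ ∃ ε : Fin 3 → Fin 3 → ℤˣ,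
          ∑ c, |x c - ∑ i, (ε i c : ℤ) * g i (j i) c| ≤ 1 := by
  intro n L g h0 h1 hstep hbox x hx
  choose f hfc hf0 hf1 hfbd hfnear using fun b =>
    NearLinearTwoClusterDecayVdbdCovering.exists_interpolation n (L b) (g b) (hstep b) (hbox b)
  have h0' : ∀ b, f b 0 b = -(n : ℝ) := fun b => by rw [hf0]; simp [h0 b]
  have h1' : ∀ b, f b 1 b = n := fun b => by rw [hf1]; simp [h1 b]
  obtain ⟨t, ε, ht⟩ := NearLinearTwoClusterDecayVdbdCovering.exists_signs_eq_sum n f hfc h0' h1'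
    hfbd (fun c => (x c : ℝ)) (fun c => ⟨by exact_mod_cast (hx c).1, by exact_mod_cast (hx c).2⟩)
  choose j hjL hjnear using fun b => hfnear b (t b)
  refine ⟨j, hjL, ε, ?_⟩
  have hε : ∀ b c, |((ε b c : ℤ) : ℝ)| = 1 := fun b c => by
    rcases Int.units_eq_one_or (ε b c) with h | h <;> simp [h]
  have key : ((∑ c, |x c - ∑ i, (ε i c : ℤ) * g i (j i) c| : ℤ) : ℝ) ≤ 3 / 2 := by
    push_cast
    calc ∑ c, |(x c : ℝ) - ∑ i, ((ε i c : ℤ) : ℝ) * (g i (j i) c : ℝ)|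
        = ∑ c, |∑ i, ((ε i c : ℤ) : ℝ) * (f i (t i) c - g i (j i) c)| := by
          refine Finset.sum_congr rfl fun c _ => ?_
          have htc : (x c : ℝ) = ∑ b, ((ε b c : ℤ) : ℝ) * f b (t b) c := ht c
          rw [htc]
          simp only [mul_sub, Finset.sum_sub_distrib]
      _ ≤ ∑ c, ∑ i, |f i (t i) c - g i (j i) c| := by
          refine Finset.sum_le_sum fun c _ => (Finset.abs_sum_le_sum_abs _ _).trans_eq ?_
          exact Finset.sum_congr rfl fun i _ => by rw [abs_mul, hε, one_mul]
      _ = ∑ i, ∑ c, |f i (t i) c - g i (j i) c| := Finset.sum_comm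
      _ ≤ ∑ _i : Fin 3, (1 / 2 : ℝ) := Finset.sum_le_sum fun i _ => hjnear i
      _ = 3 / 2 := by norm_num
  have hlt : (∑ c, |x c - ∑ i, (ε i c : ℤ) * g i (j i) c| : ℤ) < 2 := by
    have h2 : ((∑ c, |x c - ∑ i, (ε i c : ℤ) * g i (j i) c| : ℤ) : ℝ) < 2 :=
      key.trans_lt (by norm_num)
    exact_mod_cast h2
  omega

end Summit.CriticalPhenomena.PercolationContinuityZ3.Theorems
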